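import Summits.QuantumFields.YangMills.Theorems.BalabanUVNodesN15PerCubeGreenJetReg335
import Summits.QuantumFields.YangMills.Theorems.BalabanUVNodesN15PerCubeGreenDictionary
import Summits.QuantumFields.YangMills.Theorems.BalabanUVNodesN15PerCubeGreenCovDDictionary
import HarnessLib

/-!
# N15 = NE2, road (c) — PROGRAMME (PC), (PC-A′) «the COVARIANT GRADIENT entries of [B9] (3.42) in per-cube gauges», VIII: ★★★★ THE COVARIANT GRADIENT OF n15-c∕197's NAMED OBJECT
# `G′(U) = cGreen (cvT e U) a` DECAYS FOR EVERY `U(m)` BOND FIELD IN BAŁABAN's PRINTED CLASS (3.35) PER CUBE — `pull_μ∘mulVecLin (cgrad (cvT e U) * cGreen (cvT e U) a) ≤ B₁·e^{−(δ∕16)d}`: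
# n15-c∕275 read through the dictionaries n15-c∕266 (`scGlued = mulVecLin (cGreen …)`) and n15-c∕270 (`covD∘mulVecLin G = pull_μ∘mulVecLin (cgrad T * G)`) (dag-n15-c g26, n15-c∕276)

Cell `pub-ymgap`, seat `pub-ymgap-dag-n15-c` (generation g26; R134 (a), s1; HUMAN RULING D-0062).  `bears_on: R4∕N15 · K3⁸ SpineGivenEndpointR13SepCoPHV (stmt-QuantumFields-27366)`;
filed `--kind proof --supports stmt-QuantumFields-27366 --as helper` — COUNT-NEUTRAL.  One theorem, 0 `sorry`, no `def`.  Imports BY NAME n15-c∕275 `…PerCubeGreenJetReg335`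
(`uN_scGreenCovD_of_reg335Box`), n15-c∕266 `…PerCubeGreenDictionary` (`covLapM_add_scP_eq_mulVecLin_claplA`, `eq_mulVecLin_cGreen_of_comp_eq_id`, `isUnit_cvT`) and n15-c∕270
`…PerCubeGreenCovDDictionary` (`covD_comp_mulVecLin_eq_pull`).  Nothing in the tree is modified.

THE THEOREM `hasMaj_cgradGreen_of_reg335Box` — (PC-A′) CLOSED: for odd `L ≥ 7`, `a₀ > 0`, a colour index `ι` there are `δ, w₀, R₀, B > 0`, `c_r ≥ 0` such that on every doubled torus of the
cover (`k ≥ 1`, `L^m ≥ w₀`), at King's mass `a = a_K(a₀,L,k)·(L^k)^{d+1}`, for trace-form coordinates `e` of `𝔲(m)`, EVERY `U(m)`-valued site bond field `U` in the class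
`Reg335Cube (· + e_μ) U L^{−k} Q²_k ξ C` on the two-collar box of every cut box, and every `r_V` dominating the two explicit letter bounds with `r_V(1+|J⊕J|) + a₀|ι|(|ι|σ²+2σ) ≤ R₀`:
for EVERY direction `μ`, `pull_μ∘mulVecLin (cgrad (cvM) (L^k) (cvT e U) * cGreen (cvM) (L^k) (cvT e U) a) ≤ (1·(1 + r_Ve^{δ}c_r) + π)·B·e^{−(δ∕16)|y−y′|_T}` in dag-n15-w3's sharp site block
norm — the `μ`-component of the bond-valued covariant gradient `D_UG′(U)` of [B9] (3.42), entry 2, for the PRINTED per-cube class, NO global gauge, NO displayed row.  With n15-c∕266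
(entry 0) this is the one-grid operator-level content of (3.42) for `G′(U)` that the Landau letter's locality-in-`U` statements need (n15-c∕268's header: the `n = L^k` cancellation).

HONEST FRAMING ∕ LIMITS.  Exact dictionaries + composition of LANDED theorems on MODEL carriers (the doubled-cube torus cover, compressed TORUS Green's functions as local inverses, crude
constants; entry 2 only — the backward components `inr μ` are the same argument with `(scShift μ).symm`, not written out; entries 1, 3 of (3.42) and the two-grid defect (PC-E) NOT here);
the SHAPE of [B9] (3.42) at MODEL level, NOT the printed theorem; nothing of [B5]∕[B6]∕[B9] asserted.  NE2⁺ NOT PRINTED, NOT proved; N15 of record untouched (DISCHARGED AS CONSUMED,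
p687738); K3⁸ OPEN; counts of record UNMOVED (typed 28∕28 · discharged 8∕27); one finite 𝕋⁴ at fixed ε per index — NOT infinite volume, NOT OS on ℝ⁴, NOT a mass gap, NOT Clay.
Restate-immune (no Theses import).
-/

noncomputable section

open scoped BigOperators Matrix Matrix.Norms.L2Operator

namespace Summit.QuantumFields.YangMills.BalabanUVNodes.N15.Gluing

open Real
open Literature.MathematicalPhysics.QuantumFieldTheory.Balaban1983to89
open Literature.MathematicalPhysics.QuantumFieldTheory.Balaban1983to89.B5Prop11Plancherel (Tor fine unitVec)
open Literature.MathematicalPhysics.QuantumFieldTheory.Balaban1983to89.B11SectG (BlockNorm HasMaj)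
open Literature.MathematicalPhysics.QuantumFieldTheory.Balaban1983to89.T4EtaRateCoeffDefect (pull)
open Literature.MathematicalPhysics.QuantumFieldTheory.Balaban1983to89.B6UnitTorusCarrier (unitTorusGeo)
open Literature.MathematicalPhysics.QuantumFieldTheory.Balaban1983to89.B9Eq335RegularityClasses (Reg335Cube)
open Literature.MathematicalPhysics.QuantumFieldTheory.King1986 (aK aK_pos)
open Literature.MathematicalPhysics.QuantumFieldTheory.King1986.Torus (blockOf)
open Literature.Barriers.QuantumFields (traceForm)
open Summit.QuantumFields.YangMills.BalabanUVNodes.N15.BackgroundLayer (covLapM covLapM_apply)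
open Summit.QuantumFields.YangMills.BalabanUVNodes.N15.MatrixSpecies (mmulOp coordMat basisConst liftEquiv covD)
open Summit.QuantumFields.YangMills.BalabanUVNodes.N15.TwoGrid (chiCube cubeBlocks)
open Summit.QuantumFields.YangMills.BalabanUVNodes.N15.CurvedSpecies (gaugePair gaugePair_inl gaugePair_inr uN_coordMat_conj_orthogonal)
open Summit.QuantumFields.YangMills.BalabanUVNodes.N15.CovLandau (cgrad csavg claplA cGreen cgrad_mulVec claplA_mul_cGreen)

variable {d : ℕ}

section Green

variable {L : ℕ} [NeZero L]

/-- ★★★★ **THE COVARIANT GRADIENT OF THE NAMED GREEN's FUNCTION `G′(U) = cGreen (cvT e U) a` DECAYS FOR EVERY `U(m)` BOND FIELD IN BAŁABAN's PRINTED CLASS (3.35) PER CUBE** —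
entry 2 of [B9] (3.42) with per-cube gauges, (PC-A′) closed: under n15-c∕275's data, for every direction `μ`,
`pull_μ∘mulVecLin (cgrad (cvT e U) * cGreen (cvT e U) a) ≤ (1·(1 + r_Ve^{δ}c_r) + π)·B·e^{−(δ∕16)|y−y′|_T}`.  MODEL carriers; the SHAPE of (3.42), not the printed theorem.
[cite: Balaban1985BackgroundPropagators, (3.42) p.397, (3.34)–(3.35) p.396, (3.23) p.394, (3.50) p.400, Cor. 3.6 p.408, Thm 3.7 (3.90) p.409 (shape ∕ mechanism); Balaban1984PropagatorsII, (2.91)–(2.93) p.239] -/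
theorem hasMaj_cgradGreen_of_reg335Box (hL : Odd L ∧ 1 < L) (hL7 : 7 ≤ L) {a₀ : ℝ} (ha₀ : 0 < a₀) (ι : Type) [Fintype ι] [DecidableEq ι] :
    ∃ δ w₀ R₀ B cR : ℝ, 0 < δ ∧ 0 < R₀ ∧ 0 < B ∧ 0 ≤ cR ∧
      ∀ (mv kk : ℕ), 1 ≤ kk → w₀ ≤ ((L ^ mv : ℕ) : ℝ) →
      ∀ {mm : Type} [Fintype mm] [DecidableEq mm] [Nonempty mm] (e : Matrix mm mm ℂ ≃L[ℝ] (ι → ℝ)), (∀ A B : Matrix mm mm ℂ, traceForm A B = e A ⬝ᵥ e B) →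
      ∀ (U : Fin (d + 1) → ScX d L mv kk hL → (Matrix mm mm ℂ)ˣ), (∀ μ x, (U μ x : Matrix mm mm ℂ) ∈ Matrix.unitaryGroup mm ℂ) →
      ∀ (ξ C : ℝ), 0 < ξ → 0 ≤ C →
        (∀ k, Reg335Cube (scShift d L mv kk hL) U ((((L ^ kk : ℕ) : ℝ))⁻¹) {x : ScX d L mv kk hL | blockOf (L ^ kk) (cvM d L mv kk hL) x ∈ cubeBlocks (cvM d L mv kk hL) (coverCorner (cvM d L mv kk hL) (L ^ mv) L (2 * L ^ mv + 2) k) (6 * L ^ mv + 5)} ξ C) →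
      ∀ (rV : ℝ), 0 ≤ rV →
        Fintype.card ι * (@basisConst ι _ (Matrix mm mm ℂ) Matrix.frobeniusNormedAddCommGroup Matrix.frobeniusNormedSpace e * (2 * Real.sqrt (Fintype.card mm)) * (Real.sqrt (Fintype.card mm) * ((C / ξ) * Real.exp (((((L ^ kk : ℕ) : ℝ))⁻¹) * (C / ξ))))) ≤ rV →
        Fintype.card ι * (Fintype.card (Fin (d + 1)) * (Fintype.card ι * (@basisConst ι _ (Matrix mm mm ℂ) Matrix.frobeniusNormedAddCommGroup Matrix.frobeniusNormedSpace e * (2 * Real.sqrt (Fintype.card mm)) * (Real.sqrt (Fintype.card mm) * ((C / ξ) * Real.exp (((((L ^ kk : ℕ) : ℝ))⁻¹) * (C / ξ))))) ^ 2 + @basisConst ι _ (Matrix mm mm ℂ) Matrix.frobeniusNormedAddCommGroup Matrix.frobeniusNormedSpace e * (2 * Real.sqrt (Fintype.card mm)) * (Real.sqrt (Fintype.card mm) * ((C / ξ ^ 2) * Real.exp (((((L ^ kk : ℕ) : ℝ))⁻¹) * (C / ξ)))))) ≤ rV →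
        rV * (1 + Fintype.card (Fin (d + 1) ⊕ Fin (d + 1))) + a₀ * (Fintype.card ι * (Fintype.card ι * ((1 + rV * ((((L ^ kk : ℕ) : ℝ))⁻¹)) ^ ((d + 1) * L ^ kk) - 1) ^ 2 + 2 * ((1 + rV * ((((L ^ kk : ℕ) : ℝ))⁻¹)) ^ ((d + 1) * L ^ kk) - 1))) ≤ R₀ →
      ∀ μ : Fin (d + 1), HasMaj (ScNorm d L mv kk hL ι) (ScNorm d L mv kk hL ι)
          (pull (fun p : ScX d L mv kk hL × ι => ((p.1, μ), p.2)) ∘ₗ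
            Matrix.mulVecLin (cgrad (cvM d L mv kk hL) (L ^ kk) (cvT e (fun μ x => (U μ x : Matrix mm mm ℂ))) * cGreen (cvM d L mv kk hL) (L ^ kk) (cvT e (fun μ x => (U μ x : Matrix mm mm ℂ))) (aK a₀ (L : ℝ) kk * (((L ^ kk : ℕ) : ℝ)) ^ (d + 1))))
          (fun y y' => (1 * (1 + rV * Real.exp δ * cR) + π) * B * Real.exp (-(δ / 16 * (unitTorusGeo L kk (cvM d L mv kk hL)).dist y y'))) := by
  obtain ⟨δ, w₀, R₀, B, cR, hδ, hR₀, hB, hcR, H⟩ := uN_scGreenCovD_of_reg335Box (d := d) hL hL7 ha₀ ι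
  refine ⟨δ, w₀, R₀, B, cR, hδ, hR₀, hB, hcR, fun mv kk hk hw₀ => ?_⟩
  intro mm _ _ _ e he U hU ξ C hξ hC h335 rV hrV hrA hrC hRle μ
  obtain ⟨w, -, hjet, hleft, -⟩ := H mv kk hk hw₀ e he U hU ξ C hξ hC h335 rV hrV hrA hrC hRle
  have hL1r : (1 : ℝ) < (L : ℝ) := by exact_mod_cast hL.2
  have ha' : 0 < (aK a₀ (L : ℝ) kk * (((L ^ kk : ℕ) : ℝ)) ^ (d + 1)) := mul_pos (aK_pos ha₀ hL1r hk) (by positivity)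
  have hU' : ∀ μ x, ((U μ x : Matrix mm mm ℂ))ᴴ * (U μ x : Matrix mm mm ℂ) = 1 := fun μ x => Matrix.mem_unitaryGroup_iff'.mp (hU μ x)
  rw [covLapM_add_scP_eq_mulVecLin_claplA ι e he (aK a₀ (L : ℝ) kk * (((L ^ kk : ℕ) : ℝ)) ^ (d + 1)) (fun μ x => (U μ x : Matrix mm mm ℂ)) hU'] at hleft
  have hG := eq_mulVecLin_cGreen_of_comp_eq_id (isUnit_cvT ι e he (fun μ x => (U μ x : Matrix mm mm ℂ)) hU') ha' hleft
  have h := hjet μ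
  rw [hG, show covD ((((L ^ kk : ℕ) : ℝ))⁻¹) (fun x => coordMat e (ContinuousLinearMap.mulLeftRight ℝ (Matrix mm mm ℂ) (U μ x : Matrix mm mm ℂ) (U μ x : Matrix mm mm ℂ)ᴴ)) (scShift d L mv kk hL μ) =
      covD ((((L ^ kk : ℕ) : ℝ))⁻¹) (cvT e (fun μ x => (U μ x : Matrix mm mm ℂ)) μ) (fun x => x + unitVec (fine (L ^ kk) (cvM d L mv kk hL)) μ) from rfl,
    covD_comp_mulVecLin_eq_pull (cvM d L mv kk hL) (L ^ kk) (cvT e (fun μ x => (U μ x : Matrix mm mm ℂ))) μ] at h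
  exact h

end Green

end Summit.QuantumFields.YangMills.BalabanUVNodes.N15.Gluing

end
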